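import Mathlib
import Literature.MathematicalPhysics.QuantumFieldTheory.Balaban1983to89.T4AveragingDeficitGaugeLift

/-!
# T4AveragingDeficitTwoLevel — the variational closure of the NE3 energy route in the abelian model: Fermat's theorem for the fine constrained minimiser (composite averaging constraint `Q′(Qw) = V′` and Landau-type gauge condition) and the TWO-LEVEL RESIDUAL THEOREM «the block average of the two-level constrained minimiser is an O(K)-approximate critical point, in the dual coarse curvature-energy norm on ker Q′, of the coarse action» — the structure of B11 Prop. 6 / (115)–(121) realised for the quadratic abelian action and the linear average (cell `pub-balaban`, T4-DAG node U1 (b), spine estimate NE3, row T4-U1b.NE3-PROVE-P2d*, GEN 4; [folklore] glue)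

HONEST FRAMING (cell `pub-balaban`, T4-DAG PAGE 1).  The cell's T4 target is the existence AND uniqueness of the
continuum limit of Bałaban's unit-scale averaged loop expectations on a FINITE torus T⁴ — strictly beyond ultraviolet
stability; NO mass gap statement, NOT the Clay problem, NOT summit progress.  This file is GLUE of the NE3
energy-convexity seat (P2).  The seat's spine estimate NE3 (U1 (b)) is the η-rate of Bałaban's minimisers: the
configuration `U_{k+1}(V)` minimising the fine action under the COMPOSITE averaging constraint, once averaged, is close
to the minimiser of the coarse problem (B11 §E, (115)–(121), Prop. 6).  The energy route reduces this to «the averaged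
fine minimiser is an approximate critical point of the coarse constrained problem, with residual small in the dual
energy norm» (record §3, R2ᴱ) plus local strong convexity.  `T4AveragingDeficitGaugeLift` proved R2ᴱ in the abelian
model UNDER THE HYPOTHESIS of gauge-fixed fine criticality (`hcrit`).  This module discharges that hypothesis from the
honest variational one by FERMAT'S THEOREM: if `u` minimises the TOTAL fine quadratic action `actFtot = Σ_{(μ,ν)} actF μ ν`
on the admissible set `{w : Q′(Qw) = V′ ∧ R∂ᴴw = 0}` of a composite (two-level) averaging constraint — `Q′` ANY complex
matrix acting on coarse fields (e.g. the next averaging operator), `V′` any datum — then `u` is critical along every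
admissible line (`dActFtot_eq_zero_of_isMinOn`, via `hasDerivAt_actFtot` and `IsLocalMin.hasDerivAt_eq_zero`), and
consequently (`coarseResidual_twoLevel`) its block average `Qu` satisfies, for every coarse direction `φ ∈ ker Q′`,
`|D actCtot(Qu)[φ]| ≤ d² · √(2 n^d γ₁(d)) · (2√(6(d+2)) n² K) · ⟨∂₁φ, ∂₁φ⟩^{1/2}`, where `K` is the curvature-gradient
level of `u` (`u ∈ critSet μ ν K` for every plane) — i.e. `Qu` is an `O(K)`-approximate critical point of the coarse
action under the one-level constraint `Q′B = V′`, the error measured in the dual of the coarse curvature energy.  The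
transfer direction is Bałaban's constrained minimiser `H_kφ` (B5 (1.103), tree `Beta.FluctuationProjection.Hk`), the
defect bound is `defectDerivBound_abelianModel`, the lift cost `fineNorm_Hk_le`.  The only free datum is `K`: for
Bałaban's minimisers it is the printed-type regularity input ((9)ˢᵘᵖ + (10), B11 pp. 278–279; record (3.8)), asserted
nowhere in this package.  NE3 itself and the cell's conditionals (BetaPertH, (B), (B^μ)) are not mentioned.

CITATION HEADER (lean-in-tree rule 2026-08-18).  No sentence of any paper is used as a hypothesis.  Context only:
T. Bałaban, Commun. Math. Phys. **102** (1985) 277–309 [Balaban1985Variational] («B11»: (7)–(10) pp. 278–279 the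
constrained variational problem and the regularity of its solution; (75)–(76) p. 289 constraint and gauge conditions;
§E (115)–(121) p. 295 and Prop. 6 — the comparison of minimisers of composite and one-step constraints that NE3
quantifies); T. Bałaban, Commun. Math. Phys. **95** (1984) 17–40 [Balaban1984PropagatorsI] («B5»: (1.18) p. 20 the
average and its composition law; (1.91) p. 33, (1.103) p. 34 the constrained minimiser `H_k`).
[cite: Balaban1985Variational, (7)–(10) pp. 278–279, (75)–(76) p. 289, (115)–(121) p. 295 (context only);
Balaban1984PropagatorsI, (1.18) p. 20, (1.91) p. 33, (1.103) p. 34 (definitions / context)]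

WHAT IS PROVED (all [folklore], sorry-free).  §1 `actFtot`, `actCtot` (total fine / coarse quadratic actions, sums
over ordered planes), `dActFtot`, `dActCtot` (their first variations as ℝ-linear functionals, `_apply` lemmas),
`hasDerivAt_actFtot`, `hasDerivAt_actCtot` (CERTIFIED derivatives along lines), `actF_nonneg`, `actF_zero`,
`actFtot_nonneg`, `actFtot_zero`.  §2 FERMAT: `dActFtot_eq_zero_of_minAlong` (minimality along a line ⇒ vanishing
first variation), `admissible_line` (the admissible set of the composite constraint + gauge condition is invariant along
admissible directions), `dActFtot_eq_zero_of_isMinOn` (a minimiser on the admissible set is critical along every `ψ`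
with `Q′(Qψ) = 0`, `R∂ᴴψ = 0`).  §3 THE TWO-LEVEL RESIDUAL THEOREM `coarseResidual_twoLevel` and its non-vacuity
`coarseResidual_twoLevel_nonvacuous` (`V′ = 0`, `u = 0` is an admissible minimiser in every `critSet`).

NOT CLAIMED.  Existence/uniqueness of minimisers for general data (finite-dimensional quadratic minimisation — not
needed for the statements); anything about Bałaban's non-linear average (15), SU(N)-valued fields, his minimisers
`U_k(V)`, B11's `H_k(U)`/`𝔊`, the regularity (9)–(10), β for his `𝓓` (GAPS G-ne3p2-1, [analysis]), or NE3.  Record: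
HOME/t4/T4-EST-NE3-P2.md v1.21 §0 (q).
-/

set_option autoImplicit false

namespace Literature.MathematicalPhysics.QuantumFieldTheory.Balaban1983to89.T4AveragingDeficitTwoLevel

open scoped BigOperators Matrix ComplexConjugate
open Finset Complex
open Literature.MathematicalPhysics.QuantumFieldTheory.Balaban1983to89.B5Prop11Plancherel
open Literature.MathematicalPhysics.QuantumFieldTheory.Balaban1983to89.B5Block118
open Literature.MathematicalPhysics.QuantumFieldTheory.Balaban1983to89.B5AverageCurlStokes
open Literature.MathematicalPhysics.QuantumFieldTheory.Balaban1983to89.B5Action121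
open Literature.MathematicalPhysics.QuantumFieldTheory.Balaban1983to89.B5Value126
open Literature.MathematicalPhysics.QuantumFieldTheory.Balaban1983to89.B5Bounds167Lattice
open Literature.MathematicalPhysics.QuantumFieldTheory.Balaban1983to89.T4AveragingDeficit
open Literature.MathematicalPhysics.QuantumFieldTheory.Balaban1983to89.T4AveragingDeficitBridge
open Literature.MathematicalPhysics.QuantumFieldTheory.Balaban1983to89.T4AveragingDeficitGaugeLift
open Literature.MathematicalPhysics.QuantumFieldTheory.Balaban1983to89.T4ConvexResponse
open Literature.MathematicalPhysics.QuantumFieldTheory.Balaban1983to89.Beta.FluctuationProjection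
open Literature.MathematicalPhysics.QuantumFieldTheory.Balaban1983to89.Beta.Ineq167OperatorUpper

noncomputable section

variable {d : ℕ} (n : ℕ) [NeZero n] (M : Fin d → ℕ) [hM : ∀ μ, NeZero (M μ)]

/-! ## §1 Total actions over ordered planes and their certified first variations -/

/-- The TOTAL fine quadratic action `Σ_{(μ,ν)} actF μ ν A` (ordered planes; each unordered plaquette twice, the
diagonal terms vanish). [folklore] -/
def actFtot (A : Tor (fine n M) × Fin d → ℂ) : ℝ := ∑ p : Fin d × Fin d, actF n M p.1 p.2 A

/-- The TOTAL coarse quadratic action `Σ_{(μ,ν)} actC μ ν B`. [folklore] -/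
def actCtot (B : Tor M × Fin d → ℂ) : ℝ := ∑ p : Fin d × Fin d, actC n M p.1 p.2 B

/-- First variation of the total fine action at `A`, as an ℝ-linear functional. [folklore] -/
def dActFtot (A : Tor (fine n M) × Fin d → ℂ) : (Tor (fine n M) × Fin d → ℂ) →ₗ[ℝ] ℝ :=
  ∑ p : Fin d × Fin d, dActF n M p.1 p.2 A

/-- First variation of the total coarse action at `B`, as an ℝ-linear functional. [folklore] -/
def dActCtot (B : Tor M × Fin d → ℂ) : (Tor M × Fin d → ℂ) →ₗ[ℝ] ℝ :=
  ∑ p : Fin d × Fin d, dActC n M p.1 p.2 B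

/-- Unfolding lemma. [folklore] -/
theorem dActFtot_apply (A ψ : Tor (fine n M) × Fin d → ℂ) :
    dActFtot n M A ψ = ∑ p : Fin d × Fin d, dActF n M p.1 p.2 A ψ := by
  simp [dActFtot, LinearMap.sum_apply]

omit [NeZero n] in
/-- Unfolding lemma. [folklore] -/
theorem dActCtot_apply (B φ : Tor M × Fin d → ℂ) :
    dActCtot n M B φ = ∑ p : Fin d × Fin d, dActC n M p.1 p.2 B φ := by
  simp [dActCtot, LinearMap.sum_apply]

/-- `dActFtot A ψ` IS the derivative of the total fine action along the line `A + sψ` at `s = 0`. [folklore] -/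
theorem hasDerivAt_actFtot (A ψ : Tor (fine n M) × Fin d → ℂ) :
    HasDerivAt (fun s : ℝ => actFtot n M (A + (s : ℂ) • ψ)) (dActFtot n M A ψ) 0 := by
  rw [dActFtot_apply]
  have hfun : (fun s : ℝ => actFtot n M (A + (s : ℂ) • ψ))
      = ∑ p : Fin d × Fin d, fun s : ℝ => actF n M p.1 p.2 (A + (s : ℂ) • ψ) := by
    funext s; simp only [actFtot, Finset.sum_apply]
  rw [hfun]
  exact HasDerivAt.sum fun (p : Fin d × Fin d) _ => hasDerivAt_actF n M p.1 p.2 A ψ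

omit [NeZero n] in
/-- `dActCtot B φ` IS the derivative of the total coarse action along the line `B + sφ` at `s = 0`. [folklore] -/
theorem hasDerivAt_actCtot (B φ : Tor M × Fin d → ℂ) :
    HasDerivAt (fun s : ℝ => actCtot n M (B + (s : ℂ) • φ)) (dActCtot n M B φ) 0 := by
  rw [dActCtot_apply]
  have hfun : (fun s : ℝ => actCtot n M (B + (s : ℂ) • φ))
      = ∑ p : Fin d × Fin d, fun s : ℝ => actC n M p.1 p.2 (B + (s : ℂ) • φ) := by
    funext s; simp only [actCtot, Finset.sum_apply]
  rw [hfun]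
  exact HasDerivAt.sum fun (p : Fin d × Fin d) _ => hasDerivAt_actC n M p.1 p.2 B φ

/-- `0 ≤ actF μ ν A`. [folklore] -/
theorem actF_nonneg (μ ν : Fin d) (A : Tor (fine n M) × Fin d → ℂ) : 0 ≤ actF n M μ ν A := by
  unfold actF; positivity

omit hM in
/-- `plaq` of the zero field vanishes. [folklore] -/
theorem plaq_zero {N : Fin d → ℕ} (μ ν : Fin d) (x : Tor N) :
    plaq N (0 : Tor N × Fin d → ℂ) μ ν x = 0 := by
  simp [plaq]

/-- `actF μ ν 0 = 0`. [folklore] -/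
theorem actF_zero (μ ν : Fin d) : actF n M μ ν (0 : Tor (fine n M) × Fin d → ℂ) = 0 := by
  simp [actF, plaq_zero]

/-- `0 ≤ actFtot A`. [folklore] -/
theorem actFtot_nonneg (A : Tor (fine n M) × Fin d → ℂ) : 0 ≤ actFtot n M A :=
  Finset.sum_nonneg fun p _ => actF_nonneg n M p.1 p.2 A

/-- `actFtot 0 = 0`. [folklore] -/
theorem actFtot_zero : actFtot n M (0 : Tor (fine n M) × Fin d → ℂ) = 0 := by
  simp [actFtot, actF_zero]

/-! ## §2 Fermat: a constrained minimiser is critical along admissible lines -/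

/-- FERMAT along a line: if the total fine action does not decrease along the line `u + sψ`, its first variation at
`u` in the direction `ψ` vanishes (certified derivative `hasDerivAt_actFtot` + `IsLocalMin.hasDerivAt_eq_zero`).
[folklore] -/
theorem dActFtot_eq_zero_of_minAlong {u ψ : Tor (fine n M) × Fin d → ℂ}
    (h : ∀ s : ℝ, actFtot n M u ≤ actFtot n M (u + (s : ℂ) • ψ)) : dActFtot n M u ψ = 0 := by
  have hloc : IsLocalMin (fun s : ℝ => actFtot n M (u + (s : ℂ) • ψ)) 0 :=
    Filter.Eventually.of_forall fun s => by simpa using h s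
  exact hloc.hasDerivAt_eq_zero (hasDerivAt_actFtot n M u ψ)

/-- The admissible set of the COMPOSITE (two-level) averaging constraint `Q′(Qw) = V′` together with the Landau-type
gauge condition `R∂ᴴw = 0`; `Q′` is any complex matrix on coarse fields (e.g. the next averaging operator of the
composition law (1.18)), `V′` any datum. [folklore] -/
def admissible {ι : Type*} (Q' : Matrix ι (Tor M × Fin d) ℂ) (V' : ι → ℂ) :
    Set (Tor (fine n M) × Fin d → ℂ) :=
  {w | Q' *ᵥ (QvOp n M *ᵥ w) = V' ∧ gaugeFix n M w}

/-- The admissible set is invariant along admissible directions: `Q′(Qψ) = 0`, `R∂ᴴψ = 0` ⇒ `u + sψ` admissible for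
every real `s` whenever `u` is. [folklore] -/
theorem admissible_line {ι : Type*} (Q' : Matrix ι (Tor M × Fin d) ℂ) (V' : ι → ℂ)
    {u ψ : Tor (fine n M) × Fin d → ℂ} (hu : u ∈ admissible n M Q' V')
    (hψ : Q' *ᵥ (QvOp n M *ᵥ ψ) = 0) (hg : gaugeFix n M ψ) (s : ℝ) :
    u + (s : ℂ) • ψ ∈ admissible n M Q' V' := by
  obtain ⟨hu1, hu2⟩ := hu
  refine ⟨?_, ?_⟩
  · rw [Matrix.mulVec_add, Matrix.mulVec_smul, Matrix.mulVec_add, Matrix.mulVec_smul, hψ, smul_zero, add_zero,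
      hu1]
  · unfold gaugeFix at hu2 hg ⊢
    rw [Matrix.mulVec_add, Matrix.mulVec_smul, Matrix.mulVec_add, Matrix.mulVec_smul, hg, smul_zero, add_zero, hu2]

/-- FERMAT for the two-level constrained problem: a minimiser of the total fine action on the admissible set
`{Q′(Qw) = V′, R∂ᴴw = 0}` has vanishing first variation in every direction `ψ` with `Q′(Qψ) = 0` and `R∂ᴴψ = 0` —
the gauge-fixed fine criticality that `T4AveragingDeficitGaugeLift.dualResidual_gaugeFixed` ASSUMED, now derived
from minimality. [folklore] -/
theorem dActFtot_eq_zero_of_isMinOn {ι : Type*} (Q' : Matrix ι (Tor M × Fin d) ℂ) (V' : ι → ℂ)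
    {u : Tor (fine n M) × Fin d → ℂ} (hu : u ∈ admissible n M Q' V')
    (hmin : IsMinOn (actFtot n M) (admissible n M Q' V') u)
    {ψ : Tor (fine n M) × Fin d → ℂ} (hψ : Q' *ᵥ (QvOp n M *ᵥ ψ) = 0) (hg : gaugeFix n M ψ) :
    dActFtot n M u ψ = 0 :=
  dActFtot_eq_zero_of_minAlong n M fun s => hmin (admissible_line n M Q' V' hu hψ hg s)

/-! ## §3 The two-level residual theorem -/

/-- Per-plane defect bound at a field of curvature-gradient level `K`, applied (the typed wall shape
`DefectDerivBound` unfolded at the instance `defectDerivBound_abelianModel`). [folklore] -/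
theorem abs_dDeficit_le (μ ν : Fin d) (K : ℝ) (hK : 0 ≤ K) {u : Tor (fine n M) × Fin d → ℂ}
    (hu : u ∈ critSet n M μ ν K) (ψ : Tor (fine n M) × Fin d → ℂ) :
    |dDeficit n M μ ν u ψ| ≤ (2 * Real.sqrt (6 * ((d : ℝ) + 2)) * (n : ℝ) ^ 2 * K) * fineNorm n M μ ν ψ := by
  have h := defectDerivBound_abelianModel n M μ ν K hK
  unfold DefectDerivBound at h
  exact h u hu ψ

/-- THE TWO-LEVEL RESIDUAL THEOREM (B11 Prop. 6 / (115)–(121) mechanism, linear abelian model).  Let `Q′` be any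
complex matrix on coarse fields and `V′` a datum; let `u` be admissible (`Q′(Qu) = V′`, `R∂ᴴu = 0`) and MINIMISE the
total fine quadratic action `actFtot` on the admissible set, and let `K ≥ 0` be a curvature-gradient level of `u` in
every plane (`u ∈ critSet μ ν K`).  Then for every coarse direction `φ` with `Q′φ = 0`:
`|D actCtot(Qu)[φ]| ≤ d² · √(2 n^d γ₁(d)) · (2√(6(d+2)) n² K) · ⟨∂₁φ, ∂₁φ⟩^{1/2}` — the block average of the two-level
constrained minimiser is an `O(K)`-APPROXIMATE CRITICAL POINT OF THE COARSE ACTION UNDER THE ONE-LEVEL CONSTRAINT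
`Q′B = V′`, the error in the dual of the coarse curvature energy, constants depending on `d` and the block size `n = L`
only.  Proof: transfer direction `ψ = H_kφ` (`QvOp_Hk_mulVec`, `gaugeFix_Hk`; admissible since `Q′(Qψ) = Q′φ = 0`),
Fermat (`dActFtot_eq_zero_of_isMinOn`), the chain identity `dDeficit_eq_chain` per plane, the defect bound
`abs_dDeficit_le` and the lift cost `fineNorm_Hk_le`, summed over the `d²` ordered planes. [folklore] -/
theorem coarseResidual_twoLevel {ι : Type*} (Q' : Matrix ι (Tor M × Fin d) ℂ) (V' : ι → ℂ) (K : ℝ) (hK : 0 ≤ K)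
    {u : Tor (fine n M) × Fin d → ℂ} (huA : u ∈ admissible n M Q' V')
    (hmin : IsMinOn (actFtot n M) (admissible n M Q' V') u) (hu : ∀ μ ν : Fin d, u ∈ critSet n M μ ν K)
    {φ : Tor M × Fin d → ℂ} (hφ : Q' *ᵥ φ = 0) :
    |dActCtot n M (QvOp n M *ᵥ u) φ|
      ≤ (d : ℝ) ^ 2 * (Real.sqrt (2 * (n : ℝ) ^ d * gamma1 d) * (2 * Real.sqrt (6 * ((d : ℝ) + 2)) * (n : ℝ) ^ 2 * K))
          * coarseEnergyNorm M φ := by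
  set ψ : Tor (fine n M) × Fin d → ℂ := Hk n NeZero.one_le M 1 one_pos *ᵥ φ with hψdef
  have hQψ : QvOp n M *ᵥ ψ = φ := QvOp_Hk_mulVec n NeZero.one_le M 1 one_pos φ
  have hgψ : gaugeFix n M ψ := gaugeFix_Hk n M 1 one_pos φ
  have hadm : Q' *ᵥ (QvOp n M *ᵥ ψ) = 0 := by rw [hQψ, hφ]
  have hF : dActFtot n M u ψ = 0 := dActFtot_eq_zero_of_isMinOn n M Q' V' huA hmin hadm hgψ
  -- chain identity summed over planes
  have hchain : dActCtot n M (QvOp n M *ᵥ u) φ = ∑ p : Fin d × Fin d, dDeficit n M p.1 p.2 u ψ := by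
    have h1 : dActCtot n M (QvOp n M *ᵥ u) φ
        = ∑ p : Fin d × Fin d, (dDeficit n M p.1 p.2 u ψ + dActF n M p.1 p.2 u ψ) := by
      rw [dActCtot_apply]
      refine Finset.sum_congr rfl fun p _ => ?_
      rw [dDeficit_eq_chain, dQ_apply, hQψ]; ring
    rw [h1, Finset.sum_add_distrib, ← dActFtot_apply, hF, add_zero]
  -- per-plane bound
  have hterm : ∀ p : Fin d × Fin d, |dDeficit n M p.1 p.2 u ψ|
      ≤ Real.sqrt (2 * (n : ℝ) ^ d * gamma1 d) * (2 * Real.sqrt (6 * ((d : ℝ) + 2)) * (n : ℝ) ^ 2 * K)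
          * coarseEnergyNorm M φ := by
    intro p
    have hδ : 0 ≤ 2 * Real.sqrt (6 * ((d : ℝ) + 2)) * (n : ℝ) ^ 2 * K := by positivity
    calc |dDeficit n M p.1 p.2 u ψ|
        ≤ (2 * Real.sqrt (6 * ((d : ℝ) + 2)) * (n : ℝ) ^ 2 * K) * fineNorm n M p.1 p.2 ψ :=
          abs_dDeficit_le n M p.1 p.2 K hK (hu p.1 p.2) ψ
      _ ≤ (2 * Real.sqrt (6 * ((d : ℝ) + 2)) * (n : ℝ) ^ 2 * K)
            * (Real.sqrt (2 * (n : ℝ) ^ d * gamma1 d) * Real.sqrt (d1Sq M φ)) :=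
          mul_le_mul_of_nonneg_left (by rw [hψdef]; exact fineNorm_Hk_le n M p.1 p.2 1 one_pos φ) hδ
      _ = Real.sqrt (2 * (n : ℝ) ^ d * gamma1 d) * (2 * Real.sqrt (6 * ((d : ℝ) + 2)) * (n : ℝ) ^ 2 * K)
            * coarseEnergyNorm M φ := by unfold coarseEnergyNorm; ring
  rw [hchain]
  calc |∑ p : Fin d × Fin d, dDeficit n M p.1 p.2 u ψ|
      ≤ ∑ p : Fin d × Fin d, |dDeficit n M p.1 p.2 u ψ| := Finset.abs_sum_le_sum_abs _ _
    _ ≤ ∑ _p : Fin d × Fin d, Real.sqrt (2 * (n : ℝ) ^ d * gamma1 d)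
          * (2 * Real.sqrt (6 * ((d : ℝ) + 2)) * (n : ℝ) ^ 2 * K) * coarseEnergyNorm M φ :=
        Finset.sum_le_sum fun p _ => hterm p
    _ = (d : ℝ) ^ 2 * (Real.sqrt (2 * (n : ℝ) ^ d * gamma1 d) * (2 * Real.sqrt (6 * ((d : ℝ) + 2)) * (n : ℝ) ^ 2 * K))
          * coarseEnergyNorm M φ := by
        rw [Finset.sum_const, Finset.card_univ, Fintype.card_prod, Fintype.card_fin, nsmul_eq_mul]
        push_cast; ring

/-- NON-VACUITY of `coarseResidual_twoLevel`: for the datum `V′ = 0` the zero field is admissible, minimises the total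
fine action on the admissible set (the action is non-negative and vanishes at `0`), and lies in every `critSet K`; admissible transfer directions exist for every `φ ∈ ker Q′` (`H_kφ`). [folklore] -/
theorem coarseResidual_twoLevel_nonvacuous {ι : Type*} (Q' : Matrix ι (Tor M × Fin d) ℂ) (K : ℝ) :
    (0 : Tor (fine n M) × Fin d → ℂ) ∈ admissible n M Q' 0 ∧
      IsMinOn (actFtot n M) (admissible n M Q' 0) 0 ∧
      (∀ μ ν : Fin d, (0 : Tor (fine n M) × Fin d → ℂ) ∈ critSet n M μ ν K) ∧
      (∀ φ : Tor M × Fin d → ℂ, Q' *ᵥ φ = 0 →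
        ∃ ψ : Tor (fine n M) × Fin d → ℂ, QvOp n M *ᵥ ψ = φ ∧ Q' *ᵥ (QvOp n M *ᵥ ψ) = 0 ∧ gaugeFix n M ψ) := by
  refine ⟨⟨by rw [Matrix.mulVec_zero, Matrix.mulVec_zero], gaugeFix_zero n M⟩, ?_, fun μ ν => ?_, fun φ hφ => ?_⟩
  · intro w _
    rw [Set.mem_setOf_eq, actFtot_zero]
    exact actFtot_nonneg n M w
  · have h0 := zero_mem_critSet n M μ ν K
    exact h0
  · refine ⟨Hk n NeZero.one_le M 1 one_pos *ᵥ φ, QvOp_Hk_mulVec n NeZero.one_le M 1 one_pos φ, ?_,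
      gaugeFix_Hk n M 1 one_pos φ⟩
    rw [QvOp_Hk_mulVec, hφ]

end

end Literature.MathematicalPhysics.QuantumFieldTheory.Balaban1983to89.T4AveragingDeficitTwoLevel
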